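import Literature.AlgebraicGeometry.Deformation.TangentSpaceVectorSpace
import Mathlib.RingTheory.Derivation.ToSquareZero
import Mathlib.RingTheory.Ideal.Cotangent
import Mathlib.Algebra.TrivSqZeroExt.Ideal
import HarnessLib

/-!
# [Schlessinger1968, Lemma 2.10] on functors of points: the vector space structure on `t_R = Hom_k(R, k[V])` is the
pointwise one; «`Hom(A, k[V]) ≅ Der_Λ(A, V)`»; «`t_F ≅ t_R`» for `F = h_R`; (H₃) for `h_A`, `A ∈ Art_k`; the action
(2.17) on `h_R` is `(v · g)(r) = g(r) + (v(r) − v(r)₀ · 1)`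

Family `hodge` (computation cell `pub-hsemireg`, LIT-W seat «Pridham / derived deformation theory as printed»), layer
`Literature/AlgebraicGeometry/Deformation`; a sanity companion of `TangentSpaceVectorSpace.lean`.

[Schlessinger1968, (2.6) Notation, p. 211]: «For any functor `F`, the set `F(k[ε])` is called the tangent space to `F`, and is
denoted by `t_F`. It is easy to see that if `F = h_R`, then there is a canonical isomorphism `t_F ≅ t_R`:
`t_R ≅ Hom_Λ(R, k[ε])`.» [Schlessinger1968, Lemma 2.10, proof, p. 212]: «The addition map `k[V] ×_k k[V] → k[V]` is
given by `(x, 0) ↦ x`, `(0, x) ↦ x` (`x ∈ V`), and scalar multiplication by `a ∈ k` is given by the endomorphism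
`x ↦ ax` (`x ∈ V`) of `k[V]`. Thus if `F` commutes with the necessary products, `F(k[V])` gets a vector space
structure.» For the functor of points `h_R = Hom_k(R, −)` (`ArtinFunctor.points R`, any `k`-algebra `R` with `h_R(k)`
a point — e.g. `R ∈ Art_k`, `ArtinFunctor.points_base_eq`) this structure (`ArtinFunctor.tangentAddCommGroup`,
`ArtinFunctor.tangentModule` of `TangentSpaceVectorSpace.lean`, along `ArtinFunctor.points_isBijectiveAlong_sqZeroExtAug`)
is the obvious one: a morphism `g : R → k[V]` is `r ↦ g₀(r) + g₁(r)` with `g₀ = ` the augmentation and `g₁ : R → V`, and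

* `(g + h)₁ = g₁ + h₁`, `(g + h)₀ = g₀` (`ArtinFunctor.points_add_apply`);
* `(a • g)₁ = a g₁`, `(a • g)₀ = g₀` (`ArtinFunctor.points_smul_apply`);
* `0₁ = 0`, `0₀ = pt` (`ArtinFunctor.points_zero_apply`);

so `g ↦ g₁` is an injective `k`-linear map `t_R(V) → (R →ₗ[k] V)` (`ArtinFunctor.pointsTangentSnd`,
`ArtinFunctor.pointsTangentSnd_injective`; `ArtinFunctor.pointsHom` writes a point of `h_R(X)` as the morphism it is);
and the printed «we have a canonical isomorphism `Hom(A, k[V]) ≅ Der_Λ(A, V)`, `A ∈ Ĉ`» for `A = R`: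
`ArtinFunctor.pointsTangentEquivDerivation : t_R(V) ≃ Der_k(R, V)` — `V ⊆ k[V]` the square-zero ideal
(Mathlib's `TrivSqZeroExt.kerIdeal`, `kerIdeal_sq`), an `R`-module through `pt` (`ArtinFunctor.pointsSqZeroExtAlgebra`,
`pointsSqZeroExt_isScalarTower`) — obtained from Mathlib's `derivationToSquareZeroEquivLift` (derivations into a
square-zero ideal `I ⊆ B` ↔ lifts `A → B` of `A → B/I`) read backwards: EVERY point `g ∈ h_R(k[V])` is a lift of
`pt : R → k = k[V]/V` (`ArtinFunctor.points_comp_mk_eq`, since `h_R(k)` is a point); on points `g ↦ (r ↦ g(r) − pt(r)·1)`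
(`pointsTangentEquivDerivation_apply`, `rfl`), and ADDITIVE for Lemma 2.10's structure
(`ArtinFunctor.pointsTangentAddEquivDerivation : t_R(V) ≃+ Der_k(R, V)`). And the printed «if `F = h_R`, then there
is a canonical isomorphism `t_F ≅ t_R`» ([Schlessinger1968, (2.6), p. 211]; `t_R = (𝔪/𝔪²)^*` over `Λ = k`) in the form
**`ArtinFunctor.pointsTangentEquivCotangentHom : t_R(V) ≃ₗ[k] Hom_k(I/I², V)`**, `I = ker pt` (`ArtinFunctor.pointsKer`;
for `V = k` literally (2.6)'s `t_R = (𝔪_R/𝔪_R²)^∨`: `ArtinFunctor.pointsTangentEquivCotangentDual : t_R ≃ₗ[k] Module.Dual k (I/I²)`;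
`I/I²` = Mathlib's `Ideal.Cotangent`), `k`-LINEAR for the structure of Lemma 2.10: the map `g ↦ (x̄ ↦ g(x)₁)`
(`pointsTangentToCotangentHom`, through `Ideal.Cotangent.lift`: on `I` the `V`-part of `g` kills products,
`pointsSndLinear_mul_eq_zero`) is injective (`…_injective`: `g(r)₁ = g(r − pt(r)·1)₁`) and surjective
(`…_surjective`: `φ` is hit by the point `r ↦ pt(r)·1 + φ([r − pt(r)·1]) ε`, `ArtinFunctor.pointsOfCotangentHom`, an
algebra map because the Leibniz defect of `r ↦ r − pt(r)·1` (`pointsKerProj`) lies in `I²`,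
`toCotangent_pointsKerProj_mul`). For `V = k` this is `t_{h_R} ≅ (I/I²)^*`; for `R` local with residue field `k`,
`I = 𝔪_R`. Hence (H₃) «`dim_k(t_F) < ∞`» for `F = h_R` whenever `I/I²` is finite over `k`
(`ArtinFunctor.points_tangent_finite`), in particular for every `A ∈ Art_k` (`points_cotangent_finite_of_artAlg`,
`points_tangent_finite_of_artAlg`) — [Schlessinger1968, Thm. 2.11 (2) ⇒ (H₃)] for functors of points. Finally the
`Der` identification is `k`-LINEAR too (`ArtinFunctor.pointsSqZeroExt_smulCommClass`: the `k`- and `R`-actions on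
`V ⊆ k[V]` commute, so `Der_k(R, V)` is a `k`-module; `ArtinFunctor.pointsTangentLinearEquivDerivation :
t_R(V) ≃ₗ[k] Der_k(R, V)`). And Schlessinger's ACTION (2.17) on `h_R` is the expected one:
`ArtinFunctor.points_kerAct_apply` — `(v · g)(r) = g(r) + (v(r) − v(r)₀ · 1)` for `v ∈ h_R(k[I])`, `g ∈ h_R(A′)`
(through `(2.16)⁻¹ : (x, s) ↦ x + s − x₀ · 1`), i.e. «the lifts form a torsor under `Der_k(R, I)`, `D · g = g + D`»
once `v ↦ v − pt · 1` is read as a derivation. Last (§ `HullH3`, ex `HullImpliesH3.lean` v1 `0838e8fd4b38de7a` of the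
lineage, merged verbatim): [Schlessinger1968, Thm. 2.11 (1) «only if», (H₃) clause, p. 215] «The isomorphism `t_R ≅ t_F`
also proves (H₃)» — `ArtinFunctor.tangent_finite_of_surjective_points`: if `F(k) = {pt}`, (H₂) holds on the `k[ε]`-model
and SOME `Hom(R_i, k[ε]) → t_F`, `φ ↦ F(φ) ξ_i`, with `R_i ∈ Art_k` is onto, then `dim_k t_F < ∞` (that map is `k`-linear,
`natTangentLinearMap` of `TangentSpaceVectorSpace.lean` = [Manetti1999, Prop. 2.6], and `t_{R_i}` is finite-dimensional by
`points_tangent_finite_of_artAlg`). Definitions with body (identity abbrevs `pointsHom` / `pointsAug`, linear maps, an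
`Algebra` structure used via `letI`, ideals, equivalences) and theorems; no named fact.

## References

* [Schlessinger1968] M. Schlessinger, Functors of Artin rings, Trans. AMS 130 (1968) 208–222: §1 p. 209 (`t_R`) and
  (2.6) Notation p. 211 (`t_F`, «`t_F ≅ t_R : t_R ≅ Hom_Λ(R, k[ε])`»), Lemma 2.10 and its proof (p. 212:
  «`Hom(A, k[V]) ≅ Der_Λ(A, V)`»), Thm. 2.11 (H₃) (p. 212); proof of Thm. 2.11 (1) «only if», p. 215.
* [Manetti1999DeformationTheoryDGLA] M. Manetti, Deformation theory via differential graded Lie algebras, Prop. 2.6.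
* Mathlib, `Mathlib/RingTheory/Ideal/Cotangent.lean`: `Ideal.Cotangent`, `Ideal.Cotangent.lift`, `Ideal.toCotangent_eq`.
* Mathlib, `Mathlib/RingTheory/Derivation/ToSquareZero.lean`: `derivationToSquareZeroEquivLift` (N. Cavalleri, A. Yang).
-/

namespace Literature.AlgebraicGeometry.Deformation

universe u

variable {k : Type u} [Field k] (R : Type u) [CommRing R] [Algebra k R]
variable (pt : (ArtinFunctor.points (k := k) R).obj (ArtAlg.base k)) (hpt : ∀ a, a = pt)
variable (V : Type u) [AddCommGroup V] [Module k V] [Module kᵐᵒᵖ V] [IsCentralScalar k V] [Module.Finite k V]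

/-- A point `g ∈ h_R(X) = Hom_k(R, X)` as the morphism `R → X` it is (the identity, written out so that points of the
abstract `(ArtinFunctor.points R).obj X` can be applied to elements). [cite: Schlessinger1968, (2.6), p. 211 (`h_R`, `t_F`)] -/
abbrev ArtinFunctor.pointsHom {X : ArtAlg.{u} k} (g : (ArtinFunctor.points (k := k) R).obj X) : R →ₐ[k] (X : Type u) :=
  g

/-- **On `h_R`, the addition of Lemma 2.10 is pointwise on the `V`-parts and fixes the scalar part:**
`(g + h)(r) = (g(r)₀, g(r)₁ + h(r)₁)`. Proof: `g + h = k[pr₁ + pr₂] ∘ w` for the unique `w : R → k[V × V]` with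
`k[pr₁] ∘ w = g`, `k[pr₂] ∘ w = h`. [cite: Schlessinger1968, Lemma 2.10 (proof: "the addition map … `(x, 0) ↦ x,
(0, x) ↦ x`"), p. 212] -/
theorem ArtinFunctor.points_add_apply (g h : (ArtinFunctor.points (k := k) R).obj (ArtAlg.sqZeroExt (k := k) V))
    (r : R) :
    letI := (ArtinFunctor.points (k := k) R).tangentAddCommGroup pt hpt V
      (ArtinFunctor.points_isBijectiveAlong_sqZeroExtAug R V)
    (ArtinFunctor.pointsHom R (g + h) r).snd = (ArtinFunctor.pointsHom R g r).snd + (ArtinFunctor.pointsHom R h r).snd ∧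
      (ArtinFunctor.pointsHom R (g + h) r).fst = (ArtinFunctor.pointsHom R g r).fst := by
  set hV := ArtinFunctor.points_isBijectiveAlong_sqZeroExtAug (k := k) R V
  letI := (ArtinFunctor.points (k := k) R).tangentAddCommGroup pt hpt V hV
  letI := (ArtinFunctor.points (k := k) R).tangentModule pt hpt V hV
  set w := ((ArtinFunctor.points (k := k) R).sqZeroExtPairEquiv pt hpt (W := V) hV).symm (g, h) with hw
  have hg : (ArtAlg.sqZeroExtMap (k := k) (LinearMap.fst k V V)).comp w = g :=
    (ArtinFunctor.points (k := k) R).map_fst_sqZeroExtPairEquiv_symm pt hpt hV (g, h)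
  have hh : (ArtAlg.sqZeroExtMap (k := k) (LinearMap.snd k V V)).comp w = h :=
    (ArtinFunctor.points (k := k) R).map_snd_sqZeroExtPairEquiv_symm pt hpt hV (g, h)
  have hadd : g + h = (ArtAlg.sqZeroExtMap (k := k) (LinearMap.fst k V V + LinearMap.snd k V V)).comp w :=
    ((ArtinFunctor.points (k := k) R).tangentModule_smul_def pt hpt V hV 1 g h).2.1
  have hg' : ArtinFunctor.pointsHom R g r = ArtAlg.sqZeroExtMap (k := k) (LinearMap.fst k V V)
      (ArtinFunctor.pointsHom R w r) := by rw [← hg]; rfl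
  have hh' : ArtinFunctor.pointsHom R h r = ArtAlg.sqZeroExtMap (k := k) (LinearMap.snd k V V)
      (ArtinFunctor.pointsHom R w r) := by rw [← hh]; rfl
  rw [hadd, hg', hh']
  change (ArtAlg.sqZeroExtMap (k := k) (LinearMap.fst k V V + LinearMap.snd k V V) (ArtinFunctor.pointsHom R w r)).snd = _ ∧
    (ArtAlg.sqZeroExtMap (k := k) (LinearMap.fst k V V + LinearMap.snd k V V) (ArtinFunctor.pointsHom R w r)).fst = _
  simp only [ArtAlg.sqZeroExtMap_apply, TrivSqZeroExt.fst_map, TrivSqZeroExt.snd_map, LinearMap.add_apply,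
    LinearMap.fst_apply, LinearMap.snd_apply, and_self]

/-- **On `h_R`, the scalar multiplication of Lemma 2.10 scales the `V`-part:** `(a • g)(r) = (g(r)₀, a g(r)₁)`
(`a • g = k[a · id] ∘ g`). [cite: Schlessinger1968, Lemma 2.10 (proof: "scalar multiplication by `a ∈ k` is given by the
endomorphism `x ↦ ax`"), p. 212] -/
theorem ArtinFunctor.points_smul_apply (a : k) (g : (ArtinFunctor.points (k := k) R).obj (ArtAlg.sqZeroExt (k := k) V))
    (r : R) :
    letI := (ArtinFunctor.points (k := k) R).tangentAddCommGroup pt hpt V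
      (ArtinFunctor.points_isBijectiveAlong_sqZeroExtAug R V)
    letI := (ArtinFunctor.points (k := k) R).tangentModule pt hpt V
      (ArtinFunctor.points_isBijectiveAlong_sqZeroExtAug R V)
    (ArtinFunctor.pointsHom R (a • g) r).snd = a • (ArtinFunctor.pointsHom R g r).snd ∧
      (ArtinFunctor.pointsHom R (a • g) r).fst = (ArtinFunctor.pointsHom R g r).fst := by
  change (ArtAlg.sqZeroExtMap (k := k) (a • LinearMap.id : V →ₗ[k] V) (ArtinFunctor.pointsHom R g r)).snd = _ ∧
    (ArtAlg.sqZeroExtMap (k := k) (a • LinearMap.id : V →ₗ[k] V) (ArtinFunctor.pointsHom R g r)).fst = _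
  simp only [ArtAlg.sqZeroExtMap_apply, TrivSqZeroExt.fst_map, TrivSqZeroExt.snd_map, LinearMap.smul_apply,
    LinearMap.id_apply, and_self]

/-- **On `h_R`, the zero of Lemma 2.10 is `r ↦ (pt(r), 0)`** (`0 = (k → k[V]) ∘ pt`).
[cite: Schlessinger1968, Lemma 2.10 (proof), p. 212] -/
theorem ArtinFunctor.points_zero_apply (r : R) :
    letI := (ArtinFunctor.points (k := k) R).tangentAddCommGroup pt hpt V
      (ArtinFunctor.points_isBijectiveAlong_sqZeroExtAug R V)
    ArtinFunctor.pointsHom R (0 : (ArtinFunctor.points (k := k) R).obj (ArtAlg.sqZeroExt (k := k) V)) r =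
      TrivSqZeroExt.inl (ArtinFunctor.pointsHom R pt r) :=
  rfl

/-- **`g ↦ g₁ : t_R(V) = Hom_k(R, k[V]) → Hom_k(R, V)` is `k`-linear** for the structure of Lemma 2.10 (the first half
of «`Hom(A, k[V]) ≅ Der_Λ(A, V)`»; the image — the `pt`-derivations — is not characterised here). Definition with body.
[cite: Schlessinger1968, Lemma 2.10 (proof: "we have a canonical isomorphism `Hom(A, k[V]) ≅ Der_Λ(A, V)`"), p. 212] -/
noncomputable def ArtinFunctor.pointsTangentSnd :
    letI := (ArtinFunctor.points (k := k) R).tangentAddCommGroup pt hpt V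
      (ArtinFunctor.points_isBijectiveAlong_sqZeroExtAug R V)
    letI := (ArtinFunctor.points (k := k) R).tangentModule pt hpt V
      (ArtinFunctor.points_isBijectiveAlong_sqZeroExtAug R V)
    (ArtinFunctor.points (k := k) R).obj (ArtAlg.sqZeroExt (k := k) V) →ₗ[k] (R →ₗ[k] V) :=
  letI := (ArtinFunctor.points (k := k) R).tangentAddCommGroup pt hpt V
    (ArtinFunctor.points_isBijectiveAlong_sqZeroExtAug R V)
  letI := (ArtinFunctor.points (k := k) R).tangentModule pt hpt V
    (ArtinFunctor.points_isBijectiveAlong_sqZeroExtAug R V)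
  { toFun := fun g =>
      { toFun := fun r => (ArtinFunctor.pointsHom R g r).snd
        map_add' := fun r s => by rw [map_add]; rfl
        map_smul' := fun c r => by rw [map_smul]; rfl }
    map_add' := fun g h => LinearMap.ext fun r => by
      rw [LinearMap.add_apply, LinearMap.coe_mk, AddHom.coe_mk, LinearMap.coe_mk, AddHom.coe_mk, LinearMap.coe_mk,
        AddHom.coe_mk]
      exact (ArtinFunctor.points_add_apply R pt hpt V g h r).1
    map_smul' := fun a g => LinearMap.ext fun r => by
      rw [LinearMap.smul_apply, RingHom.id_apply, LinearMap.coe_mk, AddHom.coe_mk, LinearMap.coe_mk, AddHom.coe_mk]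
      exact (ArtinFunctor.points_smul_apply R pt hpt V a g r).1 }

/-- `pointsTangentSnd g = g₁` on points (by `rfl`). [cite: Schlessinger1968, Lemma 2.10 (proof), p. 212] -/
theorem ArtinFunctor.pointsTangentSnd_apply (g : (ArtinFunctor.points (k := k) R).obj (ArtAlg.sqZeroExt (k := k) V))
    (r : R) : ArtinFunctor.pointsTangentSnd R pt hpt V g r = (ArtinFunctor.pointsHom R g r).snd :=
  rfl

/-- **`g ↦ g₁` is injective**: `g` is recovered as `r ↦ (pt(r), g₁(r))`, its scalar part being the (unique)
augmentation. [cite: Schlessinger1968, Lemma 2.10 (proof), p. 212] -/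
theorem ArtinFunctor.pointsTangentSnd_injective :
    Function.Injective (ArtinFunctor.pointsTangentSnd R pt hpt V) := by
  intro g h hgh
  change ArtinFunctor.pointsHom R g = ArtinFunctor.pointsHom R h
  refine AlgHom.ext fun r => TrivSqZeroExt.ext ?_ (LinearMap.congr_fun hgh r)
  have hg := hpt ((ArtAlg.sqZeroExtAug (k := k) V).comp (ArtinFunctor.pointsHom R g))
  have hh := hpt ((ArtAlg.sqZeroExtAug (k := k) V).comp (ArtinFunctor.pointsHom R h))
  exact (AlgHom.congr_fun hg r).trans (AlgHom.congr_fun hh r).symm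

/-! ## [Schlessinger1968, Lemma 2.10 (proof)]: «`Hom(A, k[V]) ≅ Der_Λ(A, V)`» for the functor of points — via Mathlib's
`derivationToSquareZeroEquivLift` (lifts of `R → k = k[V]/V` to `k[V]` ↔ derivations into the square-zero ideal `V`) -/

section Derivations

variable {k : Type u} [Field k] (R : Type u) [CommRing R] [Algebra k R]
variable (pt : (ArtinFunctor.points (k := k) R).obj (ArtAlg.base k))
variable (V : Type u) [AddCommGroup V] [Module k V] [Module kᵐᵒᵖ V] [IsCentralScalar k V]

/-- `k[V]` as an `R`-algebra through the point `pt : R → k` («`V` an `A`-module via the residue map» in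
«`Der_Λ(A, V)`»). Definition with body (an `Algebra` structure, used locally via `letI`).
[cite: Schlessinger1968, Lemma 2.10 (proof), p. 212] -/
@[reducible] noncomputable def ArtinFunctor.pointsSqZeroExtAlgebra : Algebra R (TrivSqZeroExt k V) :=
  ((algebraMap k (TrivSqZeroExt k V)).comp (ArtinFunctor.pointsHom R pt).toRingHom).toAlgebra

/-- The tower `k → R → k[V]` commutes (`pt` fixes scalars). [cite: Schlessinger1968, Lemma 2.10 (proof), p. 212] -/
theorem ArtinFunctor.pointsSqZeroExt_isScalarTower :
    letI := ArtinFunctor.pointsSqZeroExtAlgebra R pt V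
    IsScalarTower k R (TrivSqZeroExt k V) :=
  letI := ArtinFunctor.pointsSqZeroExtAlgebra R pt V
  IsScalarTower.of_algebraMap_eq fun c => by
    change algebraMap k (TrivSqZeroExt k V) c =
      algebraMap k (TrivSqZeroExt k V) (ArtinFunctor.pointsHom R pt (algebraMap k R c))
    rw [AlgHom.commutes]
    rfl

/-- Every point `g ∈ h_R(k[V])` lies over `pt`: its scalar part is the (unique) augmentation, i.e. `g` is a LIFT of
`R → k = k[V]/V` in the sense of `derivationToSquareZeroEquivLift`. [cite: Schlessinger1968, Lemma 2.10 (proof), p. 212] -/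
theorem ArtinFunctor.points_comp_mk_eq (hpt : ∀ a, a = pt) [Module.Finite k V]
    (g : (ArtinFunctor.points (k := k) R).obj (ArtAlg.sqZeroExt (k := k) V)) :
    letI := ArtinFunctor.pointsSqZeroExtAlgebra R pt V
    haveI := ArtinFunctor.pointsSqZeroExt_isScalarTower R pt V
    (Ideal.Quotient.mkₐ k (TrivSqZeroExt.kerIdeal k V)).comp
        (ArtinFunctor.pointsHom R g : R →ₐ[k] TrivSqZeroExt k V) =
      IsScalarTower.toAlgHom k R (TrivSqZeroExt k V ⧸ TrivSqZeroExt.kerIdeal k V) := by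
  letI := ArtinFunctor.pointsSqZeroExtAlgebra R pt V
  haveI := ArtinFunctor.pointsSqZeroExt_isScalarTower R pt V
  refine AlgHom.ext fun r => ?_
  have hfst : (ArtinFunctor.pointsHom R g r).fst = ArtinFunctor.pointsHom R pt r :=
    AlgHom.congr_fun (hpt ((ArtAlg.sqZeroExtAug (k := k) V).comp (ArtinFunctor.pointsHom R g))) r
  change Ideal.Quotient.mk (TrivSqZeroExt.kerIdeal k V) (ArtinFunctor.pointsHom R g r) =
    Ideal.Quotient.mk (TrivSqZeroExt.kerIdeal k V) (algebraMap R (TrivSqZeroExt k V) r)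
  rw [Ideal.Quotient.eq, TrivSqZeroExt.kerIdeal, RingHom.mem_ker]
  change (ArtinFunctor.pointsHom R g r).fst - (algebraMap k (TrivSqZeroExt k V) (ArtinFunctor.pointsHom R pt r)).fst = 0
  rw [hfst, TrivSqZeroExt.algebraMap_eq_inl, TrivSqZeroExt.fst_inl, sub_self]

/-- **«`Hom(A, k[V]) ≅ Der_Λ(A, V)`» for `A = R` with `h_R(k)` a point:** `t_R(V) = Hom_k(R, k[V]) ≃ Der_k(R, V)`,
`V ⊆ k[V]` the square-zero ideal, an `R`-module through `pt` — Mathlib's `derivationToSquareZeroEquivLift` read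
backwards (every point is a lift of `R → k`, previous theorem). On points: `g ↦ (r ↦ g(r) − pt(r)·1)`, i.e. `g ↦ g₁`.
Definition with body. [cite: Schlessinger1968, Lemma 2.10 (proof: "we have a canonical isomorphism
`Hom(A, k[V]) ≅ Der_Λ(A, V)`"), p. 212] -/
noncomputable def ArtinFunctor.pointsTangentEquivDerivation (hpt : ∀ a, a = pt) [Module.Finite k V] :
    letI := ArtinFunctor.pointsSqZeroExtAlgebra R pt V
    (ArtinFunctor.points (k := k) R).obj (ArtAlg.sqZeroExt (k := k) V) ≃
      Derivation k R ↥(TrivSqZeroExt.kerIdeal k V) :=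
  letI := ArtinFunctor.pointsSqZeroExtAlgebra R pt V
  haveI := ArtinFunctor.pointsSqZeroExt_isScalarTower R pt V
  { toFun := fun g => (derivationToSquareZeroEquivLift (TrivSqZeroExt.kerIdeal k V)
        (TrivSqZeroExt.kerIdeal_sq k V)).symm ⟨ArtinFunctor.pointsHom R g, ArtinFunctor.points_comp_mk_eq R pt V hpt g⟩
    invFun := fun d => ((derivationToSquareZeroEquivLift (TrivSqZeroExt.kerIdeal k V)
        (TrivSqZeroExt.kerIdeal_sq k V)) d).1
    left_inv := fun g => by
      change ((derivationToSquareZeroEquivLift _ _) ((derivationToSquareZeroEquivLift _ _).symm _)).1 = _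
      rw [Equiv.apply_symm_apply]
    right_inv := fun d => by
      change (derivationToSquareZeroEquivLift _ _).symm _ = d
      conv_rhs => rw [← (derivationToSquareZeroEquivLift (TrivSqZeroExt.kerIdeal k V)
        (TrivSqZeroExt.kerIdeal_sq k V)).symm_apply_apply d] }

/-- On points the derivation attached to `g` is `r ↦ g(r) − pt(r) · 1` (whose `V`-part is `g(r)₁`).
[cite: Schlessinger1968, Lemma 2.10 (proof), p. 212] -/
theorem ArtinFunctor.pointsTangentEquivDerivation_apply (hpt : ∀ a, a = pt) [Module.Finite k V]
    (g : (ArtinFunctor.points (k := k) R).obj (ArtAlg.sqZeroExt (k := k) V)) (r : R) :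
    letI := ArtinFunctor.pointsSqZeroExtAlgebra R pt V
    ((ArtinFunctor.pointsTangentEquivDerivation R pt V hpt g r : ↥(TrivSqZeroExt.kerIdeal k V)) :
        TrivSqZeroExt k V) =
      (show TrivSqZeroExt k V from ArtinFunctor.pointsHom R g r) -
        TrivSqZeroExt.inl (show k from ArtinFunctor.pointsHom R pt r) :=
  rfl

/-- **The identification `t_R(V) ≅ Der_k(R, V)` is ADDITIVE** for the structure of Lemma 2.10 on `t_R(V)` (pointwise on
`V`-parts, `ArtinFunctor.points_add_apply`) and the pointwise addition of derivations. Definition with body.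
[cite: Schlessinger1968, Lemma 2.10 (proof), p. 212] -/
noncomputable def ArtinFunctor.pointsTangentAddEquivDerivation (hpt : ∀ a, a = pt) [Module.Finite k V] :
    letI := ArtinFunctor.pointsSqZeroExtAlgebra R pt V
    letI := (ArtinFunctor.points (k := k) R).tangentAddCommGroup pt hpt V
      (ArtinFunctor.points_isBijectiveAlong_sqZeroExtAug R V)
    (ArtinFunctor.points (k := k) R).obj (ArtAlg.sqZeroExt (k := k) V) ≃+
      Derivation k R ↥(TrivSqZeroExt.kerIdeal k V) :=
  letI := ArtinFunctor.pointsSqZeroExtAlgebra R pt V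
  letI := (ArtinFunctor.points (k := k) R).tangentAddCommGroup pt hpt V
    (ArtinFunctor.points_isBijectiveAlong_sqZeroExtAug R V)
  { ArtinFunctor.pointsTangentEquivDerivation R pt V hpt with
    map_add' := fun g h => by
      refine Derivation.ext fun r => Subtype.ext ?_
      have hg : (show TrivSqZeroExt k V from ArtinFunctor.pointsHom R g r).fst =
          (show k from ArtinFunctor.pointsHom R pt r) :=
        AlgHom.congr_fun (hpt ((ArtAlg.sqZeroExtAug (k := k) V).comp (ArtinFunctor.pointsHom R g))) r
      have hh : (show TrivSqZeroExt k V from ArtinFunctor.pointsHom R h r).fst =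
          (show k from ArtinFunctor.pointsHom R pt r) :=
        AlgHom.congr_fun (hpt ((ArtAlg.sqZeroExtAug (k := k) V).comp (ArtinFunctor.pointsHom R h))) r
      obtain ⟨hs, hf⟩ := ArtinFunctor.points_add_apply R pt hpt V g h r
      change (show TrivSqZeroExt k V from ArtinFunctor.pointsHom R (g + h) r) -
          TrivSqZeroExt.inl (show k from ArtinFunctor.pointsHom R pt r) =
        ((show TrivSqZeroExt k V from ArtinFunctor.pointsHom R g r) -
            TrivSqZeroExt.inl (show k from ArtinFunctor.pointsHom R pt r)) +
          ((show TrivSqZeroExt k V from ArtinFunctor.pointsHom R h r) -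
            TrivSqZeroExt.inl (show k from ArtinFunctor.pointsHom R pt r))
      refine TrivSqZeroExt.ext ?_ ?_
      · change (show TrivSqZeroExt k V from ArtinFunctor.pointsHom R (g + h) r).fst -
            (show k from ArtinFunctor.pointsHom R pt r) =
          ((show TrivSqZeroExt k V from ArtinFunctor.pointsHom R g r).fst - (show k from ArtinFunctor.pointsHom R pt r)) +
            ((show TrivSqZeroExt k V from ArtinFunctor.pointsHom R h r).fst - (show k from ArtinFunctor.pointsHom R pt r))
        rw [hh, hf, hg, sub_self, add_zero]
      · change (show TrivSqZeroExt k V from ArtinFunctor.pointsHom R (g + h) r).snd - (0 : V) =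
          ((show TrivSqZeroExt k V from ArtinFunctor.pointsHom R g r).snd - 0) +
            ((show TrivSqZeroExt k V from ArtinFunctor.pointsHom R h r).snd - 0)
        rw [sub_zero, sub_zero, sub_zero]
        exact hs }

end Derivations

/-! ## [Schlessinger1968, (2.6) p. 211]: «`t_F ≅ t_R`» for `F = h_R` — `t_R(V) = Hom_k(R, k[V])` versus `Hom_k(I/I², V)`,
`I = ker(pt : R → k)` (Schlessinger's `t_R = (𝔪/𝔪²)^*` for local `R`, `Λ = k`) -/

section Cotangent

variable {k : Type u} [Field k] (R : Type u) [CommRing R] [Algebra k R]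
variable (pt : (ArtinFunctor.points (k := k) R).obj (ArtAlg.base k))
variable (V : Type u) [AddCommGroup V] [Module k V] [Module kᵐᵒᵖ V] [IsCentralScalar k V]

/-- The point `pt ∈ h_R(k)` as the augmentation `R → k` it is (identity, with codomain written `k` rather than the
carrier of the object `k` of `Art_k`). [cite: Schlessinger1968, (2.6), p. 211 (`h_R`, `t_F`)] -/
abbrev ArtinFunctor.pointsAug : R →ₐ[k] k :=
  pt

/-- The ideal `I = ker(pt : R → k)` (for `R ∈ Art_k` or `R` local with residue field `k`: the maximal ideal).
[cite: Schlessinger1968, §1 p. 209 (`t_R`) and (2.6) p. 211] -/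
noncomputable def ArtinFunctor.pointsKer : Ideal R :=
  RingHom.ker (ArtinFunctor.pointsAug R pt).toRingHom

/-- Membership in `I = ker pt`. [cite: Schlessinger1968, (2.6), p. 211] -/
theorem ArtinFunctor.mem_pointsKer (r : R) : r ∈ ArtinFunctor.pointsKer R pt ↔ ArtinFunctor.pointsAug R pt r = 0 :=
  RingHom.mem_ker

/-- `r − pt(r) · 1 ∈ I`. [cite: Schlessinger1968, (2.6), p. 211] -/
theorem ArtinFunctor.sub_algebraMap_mem_pointsKer (r : R) :
    r - algebraMap k R (ArtinFunctor.pointsAug R pt r) ∈ ArtinFunctor.pointsKer R pt := by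
  rw [ArtinFunctor.mem_pointsKer, map_sub, AlgHom.commutes, sub_eq_zero]
  rfl

/-- The `V`-part of a point `g ∈ h_R(k[V])` as a `k`-linear map `R → V`. Definition with body.
[cite: Schlessinger1968, Lemma 2.10 (proof), p. 212] -/
noncomputable def ArtinFunctor.pointsSndLinear [Module.Finite k V]
    (g : (ArtinFunctor.points (k := k) R).obj (ArtAlg.sqZeroExt (k := k) V)) : R →ₗ[k] V where
  toFun r := (ArtinFunctor.pointsHom R g r).snd
  map_add' r s := by rw [map_add]; rfl
  map_smul' c r := by rw [map_smul]; rfl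

/-- The scalar part of a point `g ∈ h_R(k[V])` is `pt` (when `h_R(k)` is a point).
[cite: Schlessinger1968, Lemma 2.10 (proof), p. 212] -/
theorem ArtinFunctor.points_fst_eq (hpt : ∀ a, a = pt) [Module.Finite k V]
    (g : (ArtinFunctor.points (k := k) R).obj (ArtAlg.sqZeroExt (k := k) V)) (r : R) :
    (show TrivSqZeroExt k V from ArtinFunctor.pointsHom R g r).fst = ArtinFunctor.pointsAug R pt r :=
  AlgHom.congr_fun (hpt ((ArtAlg.sqZeroExtAug (k := k) V).comp (ArtinFunctor.pointsHom R g))) r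

/-- On `I = ker pt` the `V`-part of `g` kills products: `g(xy)₁ = pt(x) g(y)₁ + pt(y) g(x)₁ = 0`.
[cite: Schlessinger1968, Lemma 2.10 (proof), p. 212] -/
theorem ArtinFunctor.pointsSndLinear_mul_eq_zero (hpt : ∀ a, a = pt) [Module.Finite k V]
    (g : (ArtinFunctor.points (k := k) R).obj (ArtAlg.sqZeroExt (k := k) V)) (x y : ↥(ArtinFunctor.pointsKer R pt)) :
    ArtinFunctor.pointsSndLinear R V g ((x : R) * y) = 0 := by
  have hx : (show TrivSqZeroExt k V from ArtinFunctor.pointsHom R g x).fst = 0 :=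
    (ArtinFunctor.points_fst_eq R pt V hpt g x).trans ((ArtinFunctor.mem_pointsKer R pt x).1 x.2)
  have hy : (show TrivSqZeroExt k V from ArtinFunctor.pointsHom R g y).fst = 0 :=
    (ArtinFunctor.points_fst_eq R pt V hpt g y).trans ((ArtinFunctor.mem_pointsKer R pt y).1 y.2)
  change (show TrivSqZeroExt k V from ArtinFunctor.pointsHom R g ((x : R) * y)).snd = 0
  rw [map_mul]
  change (show TrivSqZeroExt k V from ArtinFunctor.pointsHom R g x).fst •
      (show TrivSqZeroExt k V from ArtinFunctor.pointsHom R g y).snd +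
    MulOpposite.op (show TrivSqZeroExt k V from ArtinFunctor.pointsHom R g y).fst •
      (show TrivSqZeroExt k V from ArtinFunctor.pointsHom R g x).snd = 0
  rw [hx, hy, zero_smul, MulOpposite.op_zero, zero_smul, add_zero]

/-- **`t_R(V) → Hom_k(I/I², V)`, `g ↦ (x̄ ↦ g(x)₁)`** — the map behind «`t_F ≅ t_R`» for `F = h_R`
(`I = ker pt`; Schlessinger's `t_R = (𝔪_R/𝔪_R²)^*` for local `R` over `Λ = k`), through Mathlib's `Ideal.Cotangent.lift`.
`k`-linear for the structure of Lemma 2.10 (pointwise on `V`-parts). Definition with body.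
[cite: Schlessinger1968, (2.6), p. 211 ("if `F = h_R`, then there is a canonical isomorphism `t_F ≅ t_R`")] -/
noncomputable def ArtinFunctor.pointsTangentToCotangentHom (hpt : ∀ a, a = pt) [Module.Finite k V] :
    letI := (ArtinFunctor.points (k := k) R).tangentAddCommGroup pt hpt V
      (ArtinFunctor.points_isBijectiveAlong_sqZeroExtAug R V)
    letI := (ArtinFunctor.points (k := k) R).tangentModule pt hpt V
      (ArtinFunctor.points_isBijectiveAlong_sqZeroExtAug R V)
    (ArtinFunctor.points (k := k) R).obj (ArtAlg.sqZeroExt (k := k) V) →ₗ[k]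
      ((ArtinFunctor.pointsKer R pt).Cotangent →ₗ[k] V) :=
  letI := (ArtinFunctor.points (k := k) R).tangentAddCommGroup pt hpt V
    (ArtinFunctor.points_isBijectiveAlong_sqZeroExtAug R V)
  letI := (ArtinFunctor.points (k := k) R).tangentModule pt hpt V
    (ArtinFunctor.points_isBijectiveAlong_sqZeroExtAug R V)
  { toFun := fun g => Ideal.Cotangent.lift (R := k) (S := R) (I := ArtinFunctor.pointsKer R pt) (M := V)
      ((ArtinFunctor.pointsSndLinear R V g).comp ((ArtinFunctor.pointsKer R pt).subtype.restrictScalars k))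
      (fun x y => by
        change ArtinFunctor.pointsSndLinear R V g ((x : R) * (y : R)) = 0
        exact ArtinFunctor.pointsSndLinear_mul_eq_zero R pt V hpt g x y)
    map_add' := fun g h => by
      refine LinearMap.ext fun c => ?_
      obtain ⟨x, rfl⟩ := (ArtinFunctor.pointsKer R pt).toCotangent_surjective c
      rw [LinearMap.add_apply, Ideal.Cotangent.lift_toCotangent, Ideal.Cotangent.lift_toCotangent,
        Ideal.Cotangent.lift_toCotangent]
      exact (ArtinFunctor.points_add_apply R pt hpt V g h x).1
    map_smul' := fun a g => by
      refine LinearMap.ext fun c => ?_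
      obtain ⟨x, rfl⟩ := (ArtinFunctor.pointsKer R pt).toCotangent_surjective c
      rw [LinearMap.smul_apply, RingHom.id_apply, Ideal.Cotangent.lift_toCotangent, Ideal.Cotangent.lift_toCotangent]
      exact (ArtinFunctor.points_smul_apply R pt hpt V a g x).1 }

/-- On the class of `x ∈ I`: `(pointsTangentToCotangentHom g) x̄ = g(x)₁`. [cite: Schlessinger1968, (2.6), p. 211] -/
theorem ArtinFunctor.pointsTangentToCotangentHom_toCotangent (hpt : ∀ a, a = pt) [Module.Finite k V]
    (g : (ArtinFunctor.points (k := k) R).obj (ArtAlg.sqZeroExt (k := k) V)) (x : ↥(ArtinFunctor.pointsKer R pt)) :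
    ArtinFunctor.pointsTangentToCotangentHom R pt V hpt g ((ArtinFunctor.pointsKer R pt).toCotangent x) =
      (show TrivSqZeroExt k V from ArtinFunctor.pointsHom R g x).snd :=
  rfl

/-- **`t_R(V) → Hom_k(I/I², V)` is injective**: `g(r) = pt(r)·1 + g(r − pt(r)·1)₁ ε`-wise, and `r − pt(r)·1 ∈ I`.
[cite: Schlessinger1968, (2.6), p. 211] -/
theorem ArtinFunctor.pointsTangentToCotangentHom_injective (hpt : ∀ a, a = pt) [Module.Finite k V] :
    Function.Injective (ArtinFunctor.pointsTangentToCotangentHom R pt V hpt) := by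
  intro g h hgh
  change ArtinFunctor.pointsHom R g = ArtinFunctor.pointsHom R h
  refine AlgHom.ext fun r => TrivSqZeroExt.ext
    ((ArtinFunctor.points_fst_eq R pt V hpt g r).trans (ArtinFunctor.points_fst_eq R pt V hpt h r).symm) ?_
  -- reduce to `r - pt(r)·1 ∈ I`, where the two cotangent maps agree
  have key : ∀ g' : (ArtinFunctor.points (k := k) R).obj (ArtAlg.sqZeroExt (k := k) V),
      (show TrivSqZeroExt k V from ArtinFunctor.pointsHom R g' r).snd =
        (show TrivSqZeroExt k V from ArtinFunctor.pointsHom R g'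
          (r - algebraMap k R (ArtinFunctor.pointsAug R pt r))).snd := fun g' => by
    rw [map_sub, AlgHom.commutes]
    change _ = (show TrivSqZeroExt k V from ArtinFunctor.pointsHom R g' r).snd -
      (algebraMap k (TrivSqZeroExt k V) (ArtinFunctor.pointsAug R pt r)).snd
    rw [TrivSqZeroExt.algebraMap_eq_inl, TrivSqZeroExt.snd_inl, sub_zero]
  have hx := LinearMap.congr_fun hgh ((ArtinFunctor.pointsKer R pt).toCotangent
    ⟨_, ArtinFunctor.sub_algebraMap_mem_pointsKer R pt r⟩)
  rw [ArtinFunctor.pointsTangentToCotangentHom_toCotangent, ArtinFunctor.pointsTangentToCotangentHom_toCotangent] at hx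
  change (show TrivSqZeroExt k V from ArtinFunctor.pointsHom R g r).snd =
    (show TrivSqZeroExt k V from ArtinFunctor.pointsHom R h r).snd
  rw [key g, key h]
  exact hx

/-- `r ↦ r − pt(r) · 1 : R → I` as a `k`-linear map. Definition with body. [cite: Schlessinger1968, (2.6), p. 211] -/
noncomputable def ArtinFunctor.pointsKerProj : R →ₗ[k] ↥(ArtinFunctor.pointsKer R pt) where
  toFun r := ⟨r - algebraMap k R (ArtinFunctor.pointsAug R pt r), ArtinFunctor.sub_algebraMap_mem_pointsKer R pt r⟩
  map_add' r s := Subtype.ext (by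
    change r + s - algebraMap k R (ArtinFunctor.pointsAug R pt (r + s)) =
      (r - algebraMap k R (ArtinFunctor.pointsAug R pt r)) +
        (s - algebraMap k R (ArtinFunctor.pointsAug R pt s))
    rw [map_add, map_add]; ring)
  map_smul' c r := Subtype.ext (by
    change c • r - algebraMap k R (ArtinFunctor.pointsAug R pt (c • r)) =
      c • (r - algebraMap k R (ArtinFunctor.pointsAug R pt r))
    rw [map_smul, smul_eq_mul, map_mul, smul_sub, Algebra.smul_def, Algebra.smul_def])

/-- On `x ∈ I` the projection is the identity: `x − pt(x) · 1 = x`. [cite: Schlessinger1968, (2.6), p. 211] -/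
theorem ArtinFunctor.pointsKerProj_coe (x : ↥(ArtinFunctor.pointsKer R pt)) :
    ArtinFunctor.pointsKerProj R pt (x : R) = x := Subtype.ext (by
  change (x : R) - algebraMap k R (ArtinFunctor.pointsAug R pt x) = x
  rw [show (ArtinFunctor.pointsAug R pt x) = 0 from (ArtinFunctor.mem_pointsKer R pt x).1 x.2, map_zero,
    sub_zero])

/-- The Leibniz defect of `r ↦ r − pt(r)·1` lies in `I²`: `δ(rs) − pt(r) δ(s) − pt(s) δ(r) = δ(r) δ(s)`, so the classes
in `I/I²` satisfy `[δ(rs)] = pt(r) [δ s] + pt(s) [δ r]`. [cite: Schlessinger1968, (2.6), p. 211] -/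
theorem ArtinFunctor.toCotangent_pointsKerProj_mul (r s : R) :
    (ArtinFunctor.pointsKer R pt).toCotangent (ArtinFunctor.pointsKerProj R pt (r * s)) =
      (ArtinFunctor.pointsAug R pt r) • (ArtinFunctor.pointsKer R pt).toCotangent (ArtinFunctor.pointsKerProj R pt s) +
        (ArtinFunctor.pointsAug R pt s) •
          (ArtinFunctor.pointsKer R pt).toCotangent (ArtinFunctor.pointsKerProj R pt r) := by
  rw [← algebraMap_smul R (ArtinFunctor.pointsAug R pt r), ← algebraMap_smul R (ArtinFunctor.pointsAug R pt s),
    ← (ArtinFunctor.pointsKer R pt).toCotangent.map_smul, ← (ArtinFunctor.pointsKer R pt).toCotangent.map_smul,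
    ← (ArtinFunctor.pointsKer R pt).toCotangent.map_add, Ideal.toCotangent_eq, pow_two]
  have h : (ArtinFunctor.pointsKerProj R pt (r * s) : R) -
      ((algebraMap k R (ArtinFunctor.pointsAug R pt r) • ArtinFunctor.pointsKerProj R pt s +
        algebraMap k R (ArtinFunctor.pointsAug R pt s) • ArtinFunctor.pointsKerProj R pt r :
          ↥(ArtinFunctor.pointsKer R pt)) : R) =
      (ArtinFunctor.pointsKerProj R pt r : R) * (ArtinFunctor.pointsKerProj R pt s : R) := by
    change r * s - algebraMap k R (ArtinFunctor.pointsAug R pt (r * s)) -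
        (algebraMap k R (ArtinFunctor.pointsAug R pt r) *
            (s - algebraMap k R (ArtinFunctor.pointsAug R pt s)) +
          algebraMap k R (ArtinFunctor.pointsAug R pt s) *
            (r - algebraMap k R (ArtinFunctor.pointsAug R pt r))) =
      (r - algebraMap k R (ArtinFunctor.pointsAug R pt r)) *
        (s - algebraMap k R (ArtinFunctor.pointsAug R pt s))
    rw [map_mul, map_mul]; ring
  rw [h]
  exact Ideal.mul_mem_mul (ArtinFunctor.pointsKerProj R pt r).2 (ArtinFunctor.pointsKerProj R pt s).2

/-- **The point of `h_R(k[V])` attached to `φ : I/I² → V`: `r ↦ pt(r) · 1 + φ([r − pt(r)·1]) ε`** (an algebra map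
because the Leibniz defect of `r ↦ r − pt(r)·1` lies in `I²`). Definition with body. [cite: Schlessinger1968, (2.6), p. 211] -/
noncomputable def ArtinFunctor.pointsOfCotangentHom [Module.Finite k V]
    (φ : (ArtinFunctor.pointsKer R pt).Cotangent →ₗ[k] V) :
    (ArtinFunctor.points (k := k) R).obj (ArtAlg.sqZeroExt (k := k) V) :=
  show R →ₐ[k] TrivSqZeroExt k V from
  { toFun := fun r => TrivSqZeroExt.inl (ArtinFunctor.pointsAug R pt r) +
      TrivSqZeroExt.inr (φ ((ArtinFunctor.pointsKer R pt).toCotangent (ArtinFunctor.pointsKerProj R pt r)))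
    map_one' := by
      have h1 : ArtinFunctor.pointsKerProj R pt 1 = 0 := Subtype.ext (by
        change (1 : R) - algebraMap k R (ArtinFunctor.pointsAug R pt 1) = 0
        rw [map_one, map_one, sub_self])
      rw [map_one, h1, map_zero, map_zero, TrivSqZeroExt.inr_zero, add_zero, TrivSqZeroExt.inl_one]
    map_mul' := fun r s => by
      refine TrivSqZeroExt.ext ?_ ?_
      · simp only [TrivSqZeroExt.fst_add, TrivSqZeroExt.fst_inl, TrivSqZeroExt.fst_inr, add_zero, TrivSqZeroExt.fst_mul,
          map_mul]
      · simp only [TrivSqZeroExt.snd_add, TrivSqZeroExt.snd_inl, TrivSqZeroExt.snd_inr, zero_add, TrivSqZeroExt.snd_mul,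
          TrivSqZeroExt.fst_add, TrivSqZeroExt.fst_inl, TrivSqZeroExt.fst_inr, add_zero, op_smul_eq_smul]
        rw [ArtinFunctor.toCotangent_pointsKerProj_mul, map_add, map_smul, map_smul]
    map_zero' := by
      rw [map_zero, map_zero, map_zero, map_zero, TrivSqZeroExt.inl_zero, TrivSqZeroExt.inr_zero, add_zero]
    map_add' := fun r s => by
      rw [map_add, map_add, map_add, map_add, TrivSqZeroExt.inl_add, TrivSqZeroExt.inr_add]
      abel
    commutes' := fun c => by
      have hc : ArtinFunctor.pointsKerProj R pt (algebraMap k R c) = 0 := Subtype.ext (by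
        change algebraMap k R c - algebraMap k R (ArtinFunctor.pointsAug R pt (algebraMap k R c)) = 0
        rw [AlgHom.commutes, sub_eq_zero]; rfl)
      rw [hc, map_zero, map_zero, TrivSqZeroExt.inr_zero, add_zero, AlgHom.commutes, TrivSqZeroExt.algebraMap_eq_inl]
      rfl }

/-- The `V`-part of the point attached to `φ` on `x ∈ I` is `φ [x]`. [cite: Schlessinger1968, (2.6), p. 211] -/
theorem ArtinFunctor.pointsOfCotangentHom_snd_coe [Module.Finite k V]
    (φ : (ArtinFunctor.pointsKer R pt).Cotangent →ₗ[k] V) (x : ↥(ArtinFunctor.pointsKer R pt)) :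
    (show TrivSqZeroExt k V from ArtinFunctor.pointsHom R (ArtinFunctor.pointsOfCotangentHom R pt V φ) x).snd =
      φ ((ArtinFunctor.pointsKer R pt).toCotangent x) := by
  change (TrivSqZeroExt.inl (ArtinFunctor.pointsAug R pt x) +
      TrivSqZeroExt.inr (φ ((ArtinFunctor.pointsKer R pt).toCotangent (ArtinFunctor.pointsKerProj R pt x))) :
        TrivSqZeroExt k V).snd = _
  rw [ArtinFunctor.pointsKerProj_coe, TrivSqZeroExt.snd_add, TrivSqZeroExt.snd_inl, TrivSqZeroExt.snd_inr, zero_add]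

/-- **`t_R(V) → Hom_k(I/I², V)` is surjective** (`φ` is hit by the point `r ↦ pt(r)·1 + φ([r − pt(r)·1]) ε`).
[cite: Schlessinger1968, (2.6), p. 211] -/
theorem ArtinFunctor.pointsTangentToCotangentHom_surjective (hpt : ∀ a, a = pt) [Module.Finite k V] :
    Function.Surjective (ArtinFunctor.pointsTangentToCotangentHom R pt V hpt) := fun φ => by
  refine ⟨ArtinFunctor.pointsOfCotangentHom R pt V φ, LinearMap.ext fun c => ?_⟩
  obtain ⟨x, rfl⟩ := (ArtinFunctor.pointsKer R pt).toCotangent_surjective c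
  rw [ArtinFunctor.pointsTangentToCotangentHom_toCotangent]
  exact ArtinFunctor.pointsOfCotangentHom_snd_coe R pt V φ x

/-- **[Schlessinger1968, (2.6), p. 211] «if `F = h_R`, then there is a canonical isomorphism `t_F ≅ t_R`»:
`t_R(V) = Hom_k(R, k[V]) ≃ₗ[k] Hom_k(I/I², V)`**, `I = ker pt` (for `V = k`: `t_{h_R} ≅ (I/I²)^* = t_R`, Schlessinger's
Zariski tangent space over `Λ = k`; for `R` local with residue field `k`, `I = 𝔪_R`), `k`-linear for the structure of
Lemma 2.10. Hypotheses: any `k`-algebra `R` with `h_R(k) = {pt}`. Definition with body (`LinearEquiv.ofBijective`).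
[cite: Schlessinger1968, (2.6) p. 211 and Lemma 2.10 p. 212] -/
noncomputable def ArtinFunctor.pointsTangentEquivCotangentHom (hpt : ∀ a, a = pt) [Module.Finite k V] :
    letI := (ArtinFunctor.points (k := k) R).tangentAddCommGroup pt hpt V
      (ArtinFunctor.points_isBijectiveAlong_sqZeroExtAug R V)
    letI := (ArtinFunctor.points (k := k) R).tangentModule pt hpt V
      (ArtinFunctor.points_isBijectiveAlong_sqZeroExtAug R V)
    (ArtinFunctor.points (k := k) R).obj (ArtAlg.sqZeroExt (k := k) V) ≃ₗ[k]
      ((ArtinFunctor.pointsKer R pt).Cotangent →ₗ[k] V) :=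
  letI := (ArtinFunctor.points (k := k) R).tangentAddCommGroup pt hpt V
    (ArtinFunctor.points_isBijectiveAlong_sqZeroExtAug R V)
  letI := (ArtinFunctor.points (k := k) R).tangentModule pt hpt V
    (ArtinFunctor.points_isBijectiveAlong_sqZeroExtAug R V)
  LinearEquiv.ofBijective (ArtinFunctor.pointsTangentToCotangentHom R pt V hpt)
    ⟨ArtinFunctor.pointsTangentToCotangentHom_injective R pt V hpt,
      ArtinFunctor.pointsTangentToCotangentHom_surjective R pt V hpt⟩

/-- **[Schlessinger1968, (2.6)–(2.7), p. 211] literally, `V = k`: `t_{h_R} ≅ t_R = (𝔪_R/𝔪_R²)^∨`** (the tangent space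
of `h_R` is the `k`-dual of the cotangent space of `R` at the point; here `𝔪_R = ker pt`, `Λ = k`).
[cite: Schlessinger1968, (2.6), p. 211] [cite: Schlessinger1968, Lemma 2.10, p. 212] -/
noncomputable def ArtinFunctor.pointsTangentEquivCotangentDual (hpt : ∀ a, a = pt) :
    letI := (ArtinFunctor.points (k := k) R).tangentAddCommGroup pt hpt k
      (ArtinFunctor.points_isBijectiveAlong_sqZeroExtAug R k)
    letI := (ArtinFunctor.points (k := k) R).tangentModule pt hpt k
      (ArtinFunctor.points_isBijectiveAlong_sqZeroExtAug R k)
    (ArtinFunctor.points (k := k) R).obj (ArtAlg.sqZeroExt (k := k) k) ≃ₗ[k]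
      Module.Dual k (ArtinFunctor.pointsKer R pt).Cotangent :=
  ArtinFunctor.pointsTangentEquivCotangentHom R pt k hpt

end Cotangent

/-! ## (H₃) for functors of points: `t_{h_R}` is finite-dimensional when `I/I²` is ([Schlessinger1968, Thm. 2.11 (2) ⇒]) -/

section H3

variable {k : Type u} [Field k] (R : Type u) [CommRing R] [Algebra k R]
variable (pt : (ArtinFunctor.points (k := k) R).obj (ArtAlg.base k))

/-- **(H₃) for `h_R`: `t_{h_R} = Hom_k(R, k[ε])` is finite-dimensional as soon as `I/I²` is** (`I = ker pt`), by
`t_{h_R} ≅ (I/I²)^*` (`ArtinFunctor.pointsTangentEquivCotangentHom` with `V = k`) — Schlessinger's (H₃)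
«`dim_k(t_F) < ∞`» for pro-representable `F` ([Schlessinger1968, Thm. 2.11: (2) ⇒ (H₃)], here for functors of points
with `h_R(k) = {pt}` and `I/I²` finite over `k`, e.g. `R` Noetherian local with residue field `k`, or `R ∈ Art_k` — next
theorem). [cite: Schlessinger1968, Thm. 2.11 (H₃) p. 212 and (2.6) p. 211] -/
theorem ArtinFunctor.points_tangent_finite (hpt : ∀ a, a = pt)
    [Module.Finite k (ArtinFunctor.pointsKer R pt).Cotangent] :
    letI := (ArtinFunctor.points (k := k) R).tangentAddCommGroup pt hpt k
      (ArtinFunctor.points_isBijectiveAlong_sqZeroExtAug R k)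
    letI := (ArtinFunctor.points (k := k) R).tangentModule pt hpt k
      (ArtinFunctor.points_isBijectiveAlong_sqZeroExtAug R k)
    Module.Finite k ((ArtinFunctor.points (k := k) R).obj (ArtAlg.sqZeroExt (k := k) k)) := by
  letI := (ArtinFunctor.points (k := k) R).tangentAddCommGroup pt hpt k
    (ArtinFunctor.points_isBijectiveAlong_sqZeroExtAug R k)
  letI := (ArtinFunctor.points (k := k) R).tangentModule pt hpt k
    (ArtinFunctor.points_isBijectiveAlong_sqZeroExtAug R k)
  exact Module.Finite.equiv (ArtinFunctor.pointsTangentEquivCotangentHom R pt k hpt).symm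

/-- For `R ∈ Art_k` (finite-dimensional over `k`), `I/I²` is finite-dimensional over `k` for `I = ker` of its
augmentation, so the previous theorem applies: `t_R` is finite-dimensional — (H₃) for `h_R`, `R ∈ Art_k`.
[cite: Schlessinger1968, Thm. 2.11 (H₃), p. 212] -/
theorem ArtinFunctor.points_cotangent_finite_of_artAlg (A : ArtAlg.{u} k)
    (pt : (ArtinFunctor.points (k := k) (↥A)).obj (ArtAlg.base k)) :
    Module.Finite k (ArtinFunctor.pointsKer (↥A) pt).Cotangent := by
  haveI : Module.Finite k ↥A := A.moduleFinite
  haveI : IsNoetherian k ↥A := inferInstance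
  haveI : Module.Finite k ↥(ArtinFunctor.pointsKer (↥A) pt) :=
    Module.Finite.of_injective ((ArtinFunctor.pointsKer (↥A) pt).subtype.restrictScalars k) Subtype.val_injective
  exact Module.Finite.of_surjective ((ArtinFunctor.pointsKer (↥A) pt).toCotangent.restrictScalars k)
    (ArtinFunctor.pointsKer (↥A) pt).toCotangent_surjective

/-- **(H₃) for `h_A`, `A ∈ Art_k`: `t_A = Hom_k(A, k[ε])` is a finite-dimensional `k`-vector space** for the structure
of [Schlessinger1968, Lemma 2.10]. [cite: Schlessinger1968, Thm. 2.11 (H₃) ("`dim_k(t_F) < ∞`"), p. 212] -/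
theorem ArtinFunctor.points_tangent_finite_of_artAlg (A : ArtAlg.{u} k)
    (pt : (ArtinFunctor.points (k := k) (↥A)).obj (ArtAlg.base k)) :
    letI := (ArtinFunctor.points (k := k) (↥A)).tangentAddCommGroup pt (ArtinFunctor.points_base_eq A pt) k
      (ArtinFunctor.points_isBijectiveAlong_sqZeroExtAug (↥A) k)
    letI := (ArtinFunctor.points (k := k) (↥A)).tangentModule pt (ArtinFunctor.points_base_eq A pt) k
      (ArtinFunctor.points_isBijectiveAlong_sqZeroExtAug (↥A) k)
    Module.Finite k ((ArtinFunctor.points (k := k) (↥A)).obj (ArtAlg.sqZeroExt (k := k) k)) :=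
  haveI := ArtinFunctor.points_cotangent_finite_of_artAlg A pt
  ArtinFunctor.points_tangent_finite (↥A) pt (ArtinFunctor.points_base_eq A pt)

end H3

/-! ## `Hom_k(R, k[V]) ≅ Der_k(R, V)` is `k`-LINEAR (Lemma 2.10's structure vs the pointwise `k`-module of derivations) -/

section DerLinear

variable {k : Type u} [Field k] (R : Type u) [CommRing R] [Algebra k R]
variable (pt : (ArtinFunctor.points (k := k) R).obj (ArtAlg.base k))
variable (V : Type u) [AddCommGroup V] [Module k V] [Module kᵐᵒᵖ V] [IsCentralScalar k V]

/-- The `k`- and `R`-actions on the square-zero ideal `V ⊆ k[V]` commute (`R` acting through `pt`), so that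
`Der_k(R, V)` is a `k`-module. [cite: Schlessinger1968, Lemma 2.10 (proof), p. 212] -/
theorem ArtinFunctor.pointsSqZeroExt_smulCommClass :
    letI := ArtinFunctor.pointsSqZeroExtAlgebra R pt V
    SMulCommClass k R ↥(TrivSqZeroExt.kerIdeal k V) :=
  letI := ArtinFunctor.pointsSqZeroExtAlgebra R pt V
  ⟨fun c r i => Subtype.ext (by
    change c • (r • (i : TrivSqZeroExt k V)) = r • (c • (i : TrivSqZeroExt k V))
    rw [Algebra.smul_def, Algebra.smul_def, Algebra.smul_def, Algebra.smul_def, mul_left_comm])⟩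

/-- **`t_R(V) = Hom_k(R, k[V]) ≃ₗ[k] Der_k(R, V)`** — the identification «`Hom(A, k[V]) ≅ Der_Λ(A, V)`» is `k`-LINEAR
for the structure of Lemma 2.10 on the left and the pointwise structure on derivations. Definition with body.
[cite: Schlessinger1968, Lemma 2.10 (proof), p. 212] -/
noncomputable def ArtinFunctor.pointsTangentLinearEquivDerivation (hpt : ∀ a, a = pt) [Module.Finite k V] :
    letI := ArtinFunctor.pointsSqZeroExtAlgebra R pt V
    haveI := ArtinFunctor.pointsSqZeroExt_smulCommClass R pt V
    letI := (ArtinFunctor.points (k := k) R).tangentAddCommGroup pt hpt V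
      (ArtinFunctor.points_isBijectiveAlong_sqZeroExtAug R V)
    letI := (ArtinFunctor.points (k := k) R).tangentModule pt hpt V
      (ArtinFunctor.points_isBijectiveAlong_sqZeroExtAug R V)
    (ArtinFunctor.points (k := k) R).obj (ArtAlg.sqZeroExt (k := k) V) ≃ₗ[k]
      Derivation k R ↥(TrivSqZeroExt.kerIdeal k V) :=
  letI := ArtinFunctor.pointsSqZeroExtAlgebra R pt V
  haveI := ArtinFunctor.pointsSqZeroExt_smulCommClass R pt V
  letI := (ArtinFunctor.points (k := k) R).tangentAddCommGroup pt hpt V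
    (ArtinFunctor.points_isBijectiveAlong_sqZeroExtAug R V)
  letI := (ArtinFunctor.points (k := k) R).tangentModule pt hpt V
    (ArtinFunctor.points_isBijectiveAlong_sqZeroExtAug R V)
  { ArtinFunctor.pointsTangentAddEquivDerivation R pt V hpt with
    map_smul' := fun a g => by
      refine Derivation.ext fun r => Subtype.ext ?_
      have hg : (show TrivSqZeroExt k V from ArtinFunctor.pointsHom R g r).fst =
          (show k from ArtinFunctor.pointsHom R pt r) :=
        AlgHom.congr_fun (hpt ((ArtAlg.sqZeroExtAug (k := k) V).comp (ArtinFunctor.pointsHom R g))) r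
      obtain ⟨hs, hf⟩ := ArtinFunctor.points_smul_apply R pt hpt V a g r
      change (show TrivSqZeroExt k V from ArtinFunctor.pointsHom R (a • g) r) -
          TrivSqZeroExt.inl (show k from ArtinFunctor.pointsHom R pt r) =
        a • ((show TrivSqZeroExt k V from ArtinFunctor.pointsHom R g r) -
            TrivSqZeroExt.inl (show k from ArtinFunctor.pointsHom R pt r))
      refine TrivSqZeroExt.ext ?_ ?_
      · change (show TrivSqZeroExt k V from ArtinFunctor.pointsHom R (a • g) r).fst -
            (show k from ArtinFunctor.pointsHom R pt r) =
          a * ((show TrivSqZeroExt k V from ArtinFunctor.pointsHom R g r).fst - (show k from ArtinFunctor.pointsHom R pt r))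
        rw [hf, hg, sub_self, mul_zero]
      · change (show TrivSqZeroExt k V from ArtinFunctor.pointsHom R (a • g) r).snd - (0 : V) =
          a • ((show TrivSqZeroExt k V from ArtinFunctor.pointsHom R g r).snd - 0)
        rw [sub_zero, sub_zero]
        exact hs }

end DerLinear

/-! ## [Schlessinger1968, (2.17)] on functors of points: `(v · g)(r) = g(r) + (v(r) − v(r)₀ · 1)` -/

section ActionOnPoints

open IsLocalRing

variable {k : Type u} [Field k] (R : Type u) [CommRing R] [Algebra k R]
variable (pt : (ArtinFunctor.points (k := k) R).obj (ArtAlg.base k)) (hpt : ∀ a, a = pt)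
variable {R₀ R₁ : ArtAlg.{u} k}

/-- For `h_R`, the pair `(g, v) ∈ h_R(A′) × h_R(k[I])` IS the point `r ↦ (g r, v r)` of `h_R(A′ ×_k k[I])` (compatible
over `k` because `h_R(k)` is a point). [cite: Schlessinger1968, (2.16)–(2.17), p. 213] -/
theorem ArtinFunctor.points_fiberProdKerPairEquiv_symm (p : R₁ →ₐ[k] R₀) (hI : RingHom.ker p * maximalIdeal R₁ = ⊥)
    (aug : ↥R₁ →ₐ[k] k) (hKI : (ArtinFunctor.points (k := k) R).IsBijectiveAlong (ArtAlg.sqZeroKerAug p hI aug))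
    (v : (ArtinFunctor.points (k := k) R).obj (ArtAlg.sqZeroKer p hI)) (g : (ArtinFunctor.points (k := k) R).obj R₁) :
    ((ArtinFunctor.points (k := k) R).fiberProdKerPairEquiv pt hpt p hI aug hKI).symm (v, g) =
      ArtAlg.fiberProdLift (ArtAlg.toBase aug) (ArtAlg.sqZeroKerAug p hI aug) (ArtinFunctor.pointsHom R g)
        (ArtinFunctor.pointsHom R v)
        ((hpt ((ArtAlg.toBase aug).comp (ArtinFunctor.pointsHom R g))).trans
          (hpt ((ArtAlg.sqZeroKerAug p hI aug).comp (ArtinFunctor.pointsHom R v))).symm) := by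
  apply ((ArtinFunctor.points (k := k) R).fiberProdKerPairEquiv pt hpt p hI aug hKI).injective
  rw [Equiv.apply_symm_apply]
  rfl

/-- **(2.17) on `h_R`: `(v · g)(r) = g(r) + (v(r) − v(r)₀ · 1)`** — the action of `v ∈ h_R(k[I]) = Hom_k(R, k[I])` on
`g ∈ h_R(A′)` adds the `I`-part of `v` (through (2.16)⁻¹: `(x, s) ↦ x + s − x₀ · 1`). With `TangentSpaceOfPoints`'
identifications this is the familiar «the lifts form a torsor under `Der_k(R, I)`, `D · g = g + D`».
[cite: Schlessinger1968, (2.16)–(2.17), p. 213] -/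
theorem ArtinFunctor.points_kerAct_apply (p : R₁ →ₐ[k] R₀) (hI : RingHom.ker p * maximalIdeal R₁ = ⊥)
    (aug : ↥R₁ →ₐ[k] k) (hKI : (ArtinFunctor.points (k := k) R).IsBijectiveAlong (ArtAlg.sqZeroKerAug p hI aug))
    (v : (ArtinFunctor.points (k := k) R).obj (ArtAlg.sqZeroKer p hI)) (g : (ArtinFunctor.points (k := k) R).obj R₁)
    (r : R) :
    ArtinFunctor.pointsHom R ((ArtinFunctor.points (k := k) R).kerAct pt hpt p hI aug hKI v g) r =
      ArtinFunctor.pointsHom R g r + (ArtAlg.sqZeroKerVal p hI (ArtinFunctor.pointsHom R v r) -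
        algebraMap k R₁ (aug (ArtinFunctor.pointsHom R g r))) := by
  change ArtAlg.fiberProdSnd p p (ArtAlg.fiberProdKerInv p hI aug
    (ArtinFunctor.pointsHom R (((ArtinFunctor.points (k := k) R).fiberProdKerPairEquiv pt hpt p hI aug hKI).symm (v, g)) r)) = _
  rw [ArtinFunctor.points_fiberProdKerPairEquiv_symm R pt hpt p hI aug hKI v g, ArtAlg.fiberProdSnd_fiberProdKerInv]
  change ArtinFunctor.pointsHom R g r + ArtAlg.sqZeroKerVal p hI (ArtinFunctor.pointsHom R v r) -
      algebraMap k R₁ (aug (ArtinFunctor.pointsHom R g r)) = _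
  rw [add_sub_assoc]

end ActionOnPoints

/-! ## § HullH3 — [Schlessinger1968, Thm. 2.11 (1), «only if» direction, (H₃) clause, p. 215]: «The isomorphism
`t_R ≅ t_F` also proves (H₃)» — `dim_k t_F < ∞` as soon as some `Hom(R_i, k[ε]) → t_F`, `φ ↦ F(φ) ξ_i`, is onto with
`R_i ∈ Art_k` (ex `HullImpliesH3.lean` v1 `0838e8fd4b38de7a` of the lineage, merged verbatim: its words and its one theorem)

### Source, verbatim

[Schlessinger1968] M. Schlessinger, *Functors of Artin rings*, Trans. Amer. Math. Soc. 130 (1968) 208–222: Thm. 2.11,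
p. 212: «(H₃) `dim_k(t_F) < ∞`.»; proof of (1), «only if», p. 215: «Since `t_F ≅ t_R` we have `u_1 = u_2`, so that
`ζ_1 = ζ_2`, which proves (H₂). The isomorphism `t_R ≅ t_F` also proves (H₃).» — `t_R` being finite-dimensional for
`R` in `Ĉ` («complete Noetherian local», §1 p. 209; (2.6) p. 211: `t_R ≅ (𝔪_R/(𝔪_R² + μR))^*`).

### What is typed

On a tower / family of couples the isomorphism `t_R ≅ t_F` is read at a stage `R_i ∈ Art_k` (as in `HullTower.lean`:
`Hom(R_q, k[ε]) → t_F` bijective at every stage). THIS FILE: if `F(k) = {pt}`, (H₂) holds on the `k[ε]`-model (so that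
`t_F` is a `k`-vector space, Lemma 2.10 — for a functor with a hull (H₂) is `HullImpliesH2.lean`), and for SOME object
`R_i ∈ Art_k` with `ξ_i ∈ F(R_i)` the map `φ ↦ F(φ) ξ_i`, `Hom(R_i, k[ε]) → t_F`, is ONTO, then `dim_k t_F < ∞`
(`Module.Finite`): that map is `k`-linear (`natTangentLinearMap` for the natural family `ν = F(−) ξ_i : h_{R_i} → F`) and
`t_{R_i}` is finite-dimensional (`points_tangent_finite_of_artAlg`). One THEOREM; no definition, no named fact, no `sorry`.
-/

section HullH3

variable {k : Type u} [Field k]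

/-- **[Schlessinger1968, Thm. 2.11 (1), «only if», (H₃) clause]: «The isomorphism `t_R ≅ t_F` also proves (H₃)».**
For `F` with `F(k) = {pt}` and (H₂) on the `k[ε]`-model, if for some `R_i ∈ Art_k` and `ξ_i ∈ F(R_i)` the map
`φ ↦ F(φ) ξ_i : Hom(R_i, k[ε]) → t_F` is surjective, then `t_F` is a finite-dimensional `k`-vector space (for the structure of
Lemma 2.10). [cite: Schlessinger1968, Thm. 2.11 (H₃), p. 212, and proof of (1), p. 215]
[cite: Manetti1999DeformationTheoryDGLA, Prop. 2.6] -/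
theorem ArtinFunctor.tangent_finite_of_surjective_points (F : ArtinFunctor.{u} k) (pt : F.obj (ArtAlg.base k))
    (hpt : ∀ a, a = pt) (h2 : F.IsBijectiveAlong (ArtAlg.sqZeroExtAug (k := k) k)) (Ri : ArtAlg.{u} k) (ξ : F.obj Ri)
    (hsurj : Function.Surjective fun φ : ↥Ri →ₐ[k] ↥(ArtAlg.sqZeroExt (k := k) k) =>
      F.map (R := Ri) (S := ArtAlg.sqZeroExt (k := k) k) φ ξ) :
    letI := F.tangentAddCommGroup pt hpt k h2; letI := F.tangentModule pt hpt k h2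
    Module.Finite k (F.obj (ArtAlg.sqZeroExt (k := k) k)) := by
  -- the natural family `ν : h_{R_i} → F`, `φ ↦ F(φ) ξ_i`, with its base point and (H₂) for `h_{R_i}`
  let G := ArtinFunctor.points (k := k) ↥Ri
  obtain ⟨augi⟩ := Ri.exists_augmentation
  let ptG : G.obj (ArtAlg.base k) := ArtAlg.toBase (k := k) augi
  have hptG : ∀ a, a = ptG := ArtinFunctor.points_base_eq Ri ptG
  have h2G : G.IsBijectiveAlong (ArtAlg.sqZeroExtAug (k := k) k) :=
    ArtinFunctor.points_isBijectiveAlong_sqZeroExtAug (k := k) ↥Ri k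
  let ν : ∀ R : ArtAlg.{u} k, G.obj R → F.obj R := fun R φ => F.map (R := Ri) (S := R) φ ξ
  have hν : ∀ ⦃R T : ArtAlg.{u} k⦄ (ψ : (R : Type u) →ₐ[k] (T : Type u)) (x : G.obj R),
      ν T (G.map ψ x) = F.map ψ (ν R x) := fun R T ψ x => F.map_comp x ψ ξ
  letI := F.tangentAddCommGroup pt hpt k h2; letI := F.tangentModule pt hpt k h2
  letI := G.tangentAddCommGroup ptG hptG k h2G; letI := G.tangentModule ptG hptG k h2G
  haveI : Module.Finite k (G.obj (ArtAlg.sqZeroExt (k := k) k)) := ArtinFunctor.points_tangent_finite_of_artAlg Ri ptG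
  exact Module.Finite.of_surjective (ArtinFunctor.natTangentLinearMap ν hν ptG hptG pt hpt h2G h2) hsurj

end HullH3

end Literature.AlgebraicGeometry.Deformation
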